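import Summits.ABC.IUTFork.Thm311RealIsmDHMoverCriterion
import Literature.IUT.LogVolume.UnitLogBallFixedCriterion
import HarnessLib

/-!
# [IUTchIII] Cor. 3.12, TEAM R `indFixes` thread: the (Ind2)-FIXED balls at a finite place are ALL of one
# residue class of radii mod `e(v|p)`, or NONE — and which, in terms of `log_p(𝒪_v^×) ⊆ 𝔪_v^{1 + m/f}`

PROOF-ONLY file (0 definitions, 0 named facts) of the abc-iut cell (WAVE-5 prover seat abc-iut-w5-d039, gen 7;
TEAM R «ismDH mover» thread, lead R1 = abc-iut-c312-14, custody R2 = abc-iut-c312-15).  TAKES NO SIDE on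
[IUTchIII] Cor. 3.12.

abc-iut-w5-d180's BALL-MOVER CRITERION (`Thm311RealIsmDHMoverCriterion`, p432150): at `v ∣ p`, EVERY element of
Dupuy–Hilado's (Ind2) group `Real.ismDH logv (inr v)` fixes the ball `{‖y‖ ≤ ‖ϖ‖^j} = 𝔪_v^j` iff
`𝔪_v^j = p^k · log_p(𝒪_v^×)` for some `k`.  `Literature/IUT/LogVolume/UnitLogBallFixedCriterion.lean` (this
seat) decides the right side STRUCTURALLY: iff `∃ N, f·N = f + m ∧ log_p(𝒪_v^×) ⊆ 𝔪_v^N ∧ e ∣ j − N`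
(`f = f(v|p)`, `e = e(v|p)`, `p^m = #μ_{p^∞}(F_v)`; volume of `log_p(𝒪^×)` = [IUTchIV] Prop. 1.4 (ii); a compact
open subgroup inside a ball of the same Haar measure is that ball).  THIS FILE states the consequence for (Ind2):

* **`forall_ismDH_image_closedBall_eq_iff_exists_exponent`** — the (Ind2)-fixed balls at `v` are: NONE unless
  `f ∣ m` and every unit logarithm has norm `≤ ‖ϖ‖^{1+m/f}`; and then EXACTLY the `𝔪_v^j` with
  `j ≡ 1 + m/f (mod e(v|p))`;
* **`forall_ismDH_image_closedBall_eq_iff_dvd_sub_of_forall`** (ALL OR NONE) — if ONE ball `𝔪_v^{j₀}` is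
  (Ind2)-fixed then `𝔪_v^j` is (Ind2)-fixed iff `e(v|p) ∣ j − j₀`;
* movers: `exists_mem_ismDH_image_closedBall_ne_of_exists_norm_gt` (one unit logarithm of norm `> ‖ϖ‖^N` for
  the forced `N` ⇒ EVERY ball is moved), `…_of_not_dvd_torsionPExp` (`f ∤ m` ⇒ every ball moved);
* fixers: `forall_ismDH_image_closedBall_eq_of_logUnits_subset` (`f·N = f + m`, `log ⊆ 𝔪^N`, `e ∣ j − N` ⇒
  `𝔪_v^j` fixed) — e.g. abc-iut-w5-d172's `e ≤ p − 1 ⇒ log ⊆ 𝔪` gives, at `m = 0`, w5-d180's tame law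
  `e ∣ j − 1` up to the boundary `e = p − 1` (no `ζ_p`), abc-iut-w6-d060's cyclotomic boundary (`m = f = 1`,
  `N = 2`), the dyadic cells of w4-d017 / w5-d014 (`ℚ_2`, `ℚ_2(√3)`: `N = 2`; `ℚ_2(√−1)`: `N = 3`).

HONEST FRAMING.  Statements about Dupuy–Hilado's typed (Ind2) group acting on one-factor `q`-pilot hull-sets
(balls); which reading of [IUTchIII] Thm. 3.11 (i) (Ind2) is print's, and anything about Cor. 3.12, is for the
referee lanes / the R-lane record.  [cite: DupuyHilado2025, §4.9] [cite: WeilBNT1967, Ch. II §2, Th. 1–2]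
[cite: NeukirchANT1999, Ch. II (5.5), (5.7)] [claim: Mochizuki2012, status: disputed] for every [IUTchIII]/[IUTchIV]
locution.  Consumed BY NAME, nothing restated: `Real.ismDH`, `toR`/`ofR` (c312-5), `RescaledCompletion`,
`absRamificationIdx_rescaledCompletion`, `residueDegree_rescaledCompletion` (S7), `forall_ismDH_image_closedBall_eq_iff`
(w5-d180), `UnitLogBallFixedCriterion` (this seat).  Axioms: standard three.
-/

noncomputable section

open Set Metric NumberField IsDedekindDomain
open scoped Pointwise

namespace Summit.ABC.IUTFork.Thm311.Real

open Cor312Vol Literature.IUT.LogThetaLattice Literature.IUT.LogVolume Literature.NumberTheory.NumberFields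
open Literature.NumberTheory.GaloisRepresentations.Ultrametric

variable {F : Type} [Field F] [NumberField F] {p : ℕ} [hp : Fact p.Prime]
variable {logv : PadicLogs F} (hlog : LogvAnalyticAt p logv)
variable (v : HeightOneSpectrum (𝓞 F)) (hv : ((p : ℕ) : 𝓞 F) ∈ v.asIdeal)

include hlog

/-- **THE (Ind2)-FIXED BALLS, STRUCTURALLY.** At `v ∣ p`, for a norm uniformizer `ϖ` of `F_v` and `j ∈ ℤ`: EVERY
element of Dupuy–Hilado's (Ind2) group fixes `𝔪_v^j = {‖y‖ ≤ ‖ϖ‖^j}` iff there is `N ∈ ℤ` with `f(v|p)·N =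
f(v|p) + m` (`p^m = #μ_{p^∞}(F_v)`), `log_p(𝒪_v^×) ⊆ 𝔪_v^N`, and `e(v|p) ∣ j − N`.  Any residue characteristic, any
ramification. [cite: DupuyHilado2025, §4.9] [cite: WeilBNT1967, Ch. II §2, Th. 1–2] [cite: NeukirchANT1999, Ch. II (5.7)] -/
theorem forall_ismDH_image_closedBall_eq_iff_exists_exponent {ϖ : (RescaledCompletion F p v hv)ˣ}
    (hϖ : IsUniformizer ϖ) (j : ℤ) :
    (∀ g ∈ ismDH logv (.inr v),
        (fun a => toR p v hv (g (ofR p v hv a))) ''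
            closedBall (0 : RescaledCompletion F p v hv) ‖(ϖ : RescaledCompletion F p v hv) ^ j‖ =
          closedBall 0 ‖(ϖ : RescaledCompletion F p v hv) ^ j‖) ↔
      ∃ N : ℤ, (v.asIdeal.inertiaDeg ℤ : ℤ) * N =
          v.asIdeal.inertiaDeg ℤ + torsionPExp p (RescaledCompletion F p v hv) ∧
        logUnits (RescaledCompletion F p v hv) ⊆
          closedBall (0 : RescaledCompletion F p v hv) (‖(ϖ : RescaledCompletion F p v hv)‖ ^ N) ∧
        ((v.asIdeal.ramificationIdx ℤ : ℕ) : ℤ) ∣ j - N := by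
  have hϖ0 : (ϖ : RescaledCompletion F p v hv) ^ j ≠ 0 := zpow_ne_zero _ ϖ.ne_zero
  rw [forall_ismDH_image_closedBall_eq_iff hlog v hv hϖ0, norm_zpow,
    exists_closedBall_zpow_eq_zpow_smul_logUnits_iff p _ hϖ j, residueDegree_rescaledCompletion F p v hv,
    absRamificationIdx_rescaledCompletion F p v hv]

/-- **ALL OR NONE**: if every (Ind2)-element fixes ONE ball `𝔪_v^{j₀}`, then every (Ind2)-element fixes `𝔪_v^j`
iff `e(v|p) ∣ j − j₀` — the (Ind2)-fixed balls at `v` form exactly one residue class of radii mod `e(v|p)`, or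
are absent. [cite: DupuyHilado2025, §4.9] [cite: WeilBNT1967, Ch. II §2, Th. 2] [cite: NeukirchANT1999, Ch. II (5.7)] -/
theorem forall_ismDH_image_closedBall_eq_iff_dvd_sub_of_forall {ϖ : (RescaledCompletion F p v hv)ˣ}
    (hϖ : IsUniformizer ϖ) {j₀ : ℤ}
    (h₀ : ∀ g ∈ ismDH logv (.inr v),
      (fun a => toR p v hv (g (ofR p v hv a))) ''
          closedBall (0 : RescaledCompletion F p v hv) ‖(ϖ : RescaledCompletion F p v hv) ^ j₀‖ =
        closedBall 0 ‖(ϖ : RescaledCompletion F p v hv) ^ j₀‖) (j : ℤ) :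
    (∀ g ∈ ismDH logv (.inr v),
        (fun a => toR p v hv (g (ofR p v hv a))) ''
            closedBall (0 : RescaledCompletion F p v hv) ‖(ϖ : RescaledCompletion F p v hv) ^ j‖ =
          closedBall 0 ‖(ϖ : RescaledCompletion F p v hv) ^ j‖) ↔
      ((v.asIdeal.ramificationIdx ℤ : ℕ) : ℤ) ∣ j - j₀ := by
  set K := RescaledCompletion F p v hv
  have hϖ0 : ∀ i : ℤ, (ϖ : K) ^ i ≠ 0 := fun i => zpow_ne_zero _ ϖ.ne_zero
  have h₀' := (forall_ismDH_image_closedBall_eq_iff hlog v hv (hϖ0 j₀)).1 h₀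
  rw [norm_zpow] at h₀'
  obtain ⟨k₀, hk₀⟩ := h₀'
  rw [forall_ismDH_image_closedBall_eq_iff hlog v hv (hϖ0 j), norm_zpow,
    exists_closedBall_zpow_eq_zpow_smul_logUnits_iff_dvd_sub p K hϖ hk₀ j,
    absRamificationIdx_rescaledCompletion F p v hv]

/-- **Fixer**: `f(v|p)·N = f(v|p) + m`, `log_p(𝒪_v^×) ⊆ 𝔪_v^N` and `e(v|p) ∣ j − N` ⇒ every (Ind2)-element fixes
`𝔪_v^j`. [cite: DupuyHilado2025, §4.9] [cite: WeilBNT1967, Ch. II §2, Th. 1] [cite: NeukirchANT1999, Ch. II (5.7)] -/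
theorem forall_ismDH_image_closedBall_eq_of_logUnits_subset {ϖ : (RescaledCompletion F p v hv)ˣ}
    (hϖ : IsUniformizer ϖ) {N : ℤ}
    (hN : (v.asIdeal.inertiaDeg ℤ : ℤ) * N = v.asIdeal.inertiaDeg ℤ + torsionPExp p (RescaledCompletion F p v hv))
    (hsub : logUnits (RescaledCompletion F p v hv) ⊆
      closedBall (0 : RescaledCompletion F p v hv) (‖(ϖ : RescaledCompletion F p v hv)‖ ^ N))
    {j : ℤ} (hj : ((v.asIdeal.ramificationIdx ℤ : ℕ) : ℤ) ∣ j - N) :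
    ∀ g ∈ ismDH logv (.inr v),
      (fun a => toR p v hv (g (ofR p v hv a))) ''
          closedBall (0 : RescaledCompletion F p v hv) ‖(ϖ : RescaledCompletion F p v hv) ^ j‖ =
        closedBall 0 ‖(ϖ : RescaledCompletion F p v hv) ^ j‖ :=
  (forall_ismDH_image_closedBall_eq_iff_exists_exponent hlog v hv hϖ j).2 ⟨N, hN, hsub, hj⟩

/-- **Mover, by one large unit logarithm**: if `f(v|p)·N = f(v|p) + m` and some `z ∈ log_p(𝒪_v^×)` has
`‖z‖ > ‖ϖ‖^N`, then EVERY ball `𝔪_v^j` is moved by some (Ind2)-element. [cite: DupuyHilado2025, §4.9]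
[cite: WeilBNT1967, Ch. II §2, Th. 2] [cite: NeukirchANT1999, Ch. II (5.7)] -/
theorem exists_mem_ismDH_image_closedBall_ne_of_exists_norm_gt {ϖ : (RescaledCompletion F p v hv)ˣ}
    (hϖ : IsUniformizer ϖ) {N : ℤ}
    (hN : (v.asIdeal.inertiaDeg ℤ : ℤ) * N = v.asIdeal.inertiaDeg ℤ + torsionPExp p (RescaledCompletion F p v hv))
    (hz : ∃ z ∈ logUnits (RescaledCompletion F p v hv), ‖(ϖ : RescaledCompletion F p v hv)‖ ^ N < ‖z‖)
    (j : ℤ) :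
    ∃ g ∈ ismDH logv (.inr v),
      (fun a => toR p v hv (g (ofR p v hv a))) ''
          closedBall (0 : RescaledCompletion F p v hv) ‖(ϖ : RescaledCompletion F p v hv) ^ j‖ ≠
        closedBall 0 ‖(ϖ : RescaledCompletion F p v hv) ^ j‖ := by
  have hϖ0 : (ϖ : RescaledCompletion F p v hv) ^ j ≠ 0 := zpow_ne_zero _ ϖ.ne_zero
  rw [← residueDegree_rescaledCompletion F p v hv] at hN
  refine exists_mem_ismDH_image_closedBall_ne_of_forall_ne hlog v hv hϖ0 fun k => ?_
  rw [norm_zpow]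
  exact forall_closedBall_ne_zpow_smul_logUnits_of_exists_norm_gt p _ hϖ hN hz j k

/-- **Mover, when `f(v|p) ∤ m`**: EVERY ball `𝔪_v^j` is moved by some (Ind2)-element (e.g. `v ∣ p` odd with
`ζ_p ∈ F_v` and `f(v|p) ≥ 2`, abc-iut-w6-d060's «boundary, `f ≥ 2`: any `j`» row). [cite: DupuyHilado2025, §4.9]
[cite: WeilBNT1967, Ch. II §2, Th. 2] [cite: NeukirchANT1999, Ch. II (5.7)] -/
theorem exists_mem_ismDH_image_closedBall_ne_of_not_dvd_torsionPExp
    (hf : ¬ v.asIdeal.inertiaDeg ℤ ∣ torsionPExp p (RescaledCompletion F p v hv))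
    {ϖ : (RescaledCompletion F p v hv)ˣ} (hϖ : IsUniformizer ϖ) (j : ℤ) :
    ∃ g ∈ ismDH logv (.inr v),
      (fun a => toR p v hv (g (ofR p v hv a))) ''
          closedBall (0 : RescaledCompletion F p v hv) ‖(ϖ : RescaledCompletion F p v hv) ^ j‖ ≠
        closedBall 0 ‖(ϖ : RescaledCompletion F p v hv) ^ j‖ := by
  have hϖ0 : (ϖ : RescaledCompletion F p v hv) ^ j ≠ 0 := zpow_ne_zero _ ϖ.ne_zero
  rw [← residueDegree_rescaledCompletion F p v hv] at hf
  refine exists_mem_ismDH_image_closedBall_ne_of_forall_ne hlog v hv hϖ0 fun k => ?_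
  rw [norm_zpow]
  exact forall_closedBall_ne_zpow_smul_logUnits_of_not_dvd p _ hf hϖ j k

end Summit.ABC.IUTFork.Thm311.Real

end

-- tree-health (abc-iut-w6-d081 g4, 2026-08-26T13:50Z): comment-only re-land of a STRANDED ACCEPT (module accepted, not importable on the farm for > 100 min, two serial import probes hung);
-- declarations byte-identical to the accepted version; purpose = trigger the rebuild (w4-d014 10:34:09Z remedy class). No content change.
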